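import Mathlib
import HarnessLib
import Summits.HubbardSuperconductivity.HubbardSuperconductivity.Theorems.KLProgrammeKLRegimeSplitBundleV15

/-!
# (E3f-A) `TwoLegVolumeRateA` — THE DOOR: a general volume pair from TWO NESTED LEGS through the common multiple
# (cell gate-hubbard-kl, seat hubbard-kl-k3c4-p1 g6, technique «FST2 volume lemmas»; gen-6 bundle text T1d, plan g14 l.2070; `--supports` the engine child)

The gen-6 two-leg slot `TwoLegStepV15 … K n` (…SplitBundleV15) carries (E3f-A) `TwoLegVolumeRateA hist Q β U μ K n`: at `(L, M)` with `Q.M0 β L ≤ M`,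
GIVEN the history `hist L″ M″ K j` (`j < n`) at EVERY volume `L″ ≥ L` with `Q.M0 β L″ ≤ M″`, the local part at every `(L′, M′)`, `L ≤ L′`,
`Q.M0 β L′ ≤ M′`, is within `Q.CL β n / L` of the one at `(L, M)`.  The programme's finite-size mechanism (periodisation / semigroup defect; this seat's
VL-E3F-ROADMAP §3, k3c5-p2's VL-TWO-VOLUME-MECHANISMS §3–§4) compares a volume with its NESTED refinements only.  This module is the bookkeeping that
makes the engine lineage's (E3f-A) obligation EXACTLY two nested statements per scale:

* (i) a CUTOFF LEG at fixed volume: `L ≤ L₁`, `Q.M0 β L₁ ≤ M₁ ≤ M₂`, history at `(L₁, M₁)` and `(L₁, M₂)` ⇒ `|ν_n^{L₁,M₁} − ν_n^{L₁,M₂}| ≤ a / L₁`;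
* (ii) a SPATIAL NESTED LEG at common cutoff: `L ≤ L₁ ∣ L₂`, `Q.M0 β L₁ ≤ M₂`, `Q.M0 β L₂ ≤ M₂`, history at `(L₁, M₂)` and `(L₂, M₂)` ⇒
  `|ν_n^{L₁,M₂} − ν_n^{L₂,M₂}| ≤ b / L₁`;
with `2a + 2b ≤ Q.CL β n` ⇒ `TwoLegVolumeRateA hist Q β U μ K n` at `(L, M)` (`twoLegVolumeRateA_of_nestedLegs`): route
`(L,M) → (L,M⁺) → (L·L′,M⁺) ← (L′,M⁺) ← (L′,M′)`, `M⁺ = max (max M M′) (max (Q.M0 β (L·L′)) 1)`, every intermediate history supplied by the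
∀-volume antecedent (this is why T1d added it: the V7–V14 antecedent gave the tower at `L′` only).  `hist` is arbitrary, so the door serves
`TwoLegStepV15`'s literal antecedent and any later bundle.  Proof only; nothing is asserted about the model.
-/

noncomputable section

namespace Summit.HubbardSuperconductivity.HubbardSuperconductivity.Theorems.KLRegimeSplit

set_option linter.dupNamespace false -- summit = problem name (single-conjunct summit), D-0017

open Real Finset Literature.MathematicalPhysics.QuantumLattice Literature.Probability.LatticeModels
open Summit.HubbardSuperconductivity.HubbardSuperconductivity.Theorems.KLProgrammeLegKernels

variable {L M : ℕ} [NeZero L] [NeZero M]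
variable {hist : (L' M' : ℕ) → [NeZero L'] → [NeZero M'] → TrigPolyC4v → ℕ → Prop} {Q : EngConsts} {β U μ : ℝ} {K : TrigPolyC4v} {n : ℕ}

/-- **(E3f-A) FROM TWO NESTED LEGS.**  If, for every volume `L₁ ≥ L` carrying the history, (i) refining the Matsubara cutoff at fixed volume moves the
scale-`n` local part by at most `a / L₁` and (ii) refining the torus `L₁ ∣ L₂` at a common cutoff moves it by at most `b / L₁`, with `2a + 2b ≤ Q.CL β n`,
then `TwoLegVolumeRateA hist Q β U μ K n` holds at `(L, M)`: a general comparison volume `(L′, M′)` is reached through `(L·L′, M⁺)`. -/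
theorem twoLegVolumeRateA_of_nestedLegs {a b : ℝ} (ha : 0 ≤ a) (hb : 0 ≤ b) (hab : 2 * a + 2 * b ≤ Q.CL β n)
    (hcut : ∀ (L₁ M₁ M₂ : ℕ) [NeZero L₁] [NeZero M₁] [NeZero M₂], L ≤ L₁ → Q.M0 β L₁ ≤ M₁ → M₁ ≤ M₂ →
      (∀ j < n, hist L₁ M₁ K j) → (∀ j < n, hist L₁ M₂ K j) →
        ∀ θ : ℝ, |klLocalPart L₁ M₁ β U μ K n θ - klLocalPart L₁ M₂ β U μ K n θ| ≤ a / L₁)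
    (hsp : ∀ (L₁ L₂ M₂ : ℕ) [NeZero L₁] [NeZero L₂] [NeZero M₂], L ≤ L₁ → L₁ ∣ L₂ → Q.M0 β L₁ ≤ M₂ → Q.M0 β L₂ ≤ M₂ →
      (∀ j < n, hist L₁ M₂ K j) → (∀ j < n, hist L₂ M₂ K j) →
        ∀ θ : ℝ, |klLocalPart L₁ M₂ β U μ K n θ - klLocalPart L₂ M₂ β U μ K n θ| ≤ b / L₁) :
    TwoLegVolumeRateA L M hist Q β U μ K n := by
  intro hM hAll L' M' _ _ hLL' hM' θ
  -- the common multiple and the common cutoff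
  have hL0 : 0 < L := Nat.pos_of_ne_zero (NeZero.ne L)
  have hL'0 : 0 < L' := Nat.pos_of_ne_zero (NeZero.ne L')
  set Lp : ℕ := L * L' with hLp
  haveI : NeZero Lp := ⟨(Nat.mul_pos hL0 hL'0).ne'⟩
  set Mp : ℕ := max (max M M') (max (Q.M0 β Lp) 1) with hMp
  haveI : NeZero Mp := ⟨by
    have : 1 ≤ Mp := (le_max_right _ _).trans (le_max_right _ _)
    omega⟩
  have hMMp : M ≤ Mp := (le_max_left _ _).trans (le_max_left _ _)
  have hM'Mp : M' ≤ Mp := (le_max_right _ _).trans (le_max_left _ _)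
  have hM0Lp : Q.M0 β Lp ≤ Mp := (le_max_left _ _).trans (le_max_right _ _)
  have hM0L_Mp : Q.M0 β L ≤ Mp := hM.trans hMMp
  have hM0L'_Mp : Q.M0 β L' ≤ Mp := hM'.trans hM'Mp
  have hLLp : L ≤ Lp := by rw [hLp]; exact Nat.le_mul_of_pos_right L hL'0
  have hL'Lp : L' ≤ Lp := by rw [hLp]; exact Nat.le_mul_of_pos_left L' hL0
  have hLdvd : L ∣ Lp := Dvd.intro L' rfl
  have hL'dvd : L' ∣ Lp := Dvd.intro_left L rfl
  -- histories from the ∀-volume antecedent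
  have hH_LM : ∀ j < n, hist L M K j := hAll L M le_rfl hM
  have hH_LMp : ∀ j < n, hist L Mp K j := hAll L Mp le_rfl hM0L_Mp
  have hH_LpMp : ∀ j < n, hist Lp Mp K j := hAll Lp Mp hLLp hM0Lp
  have hH_L'Mp : ∀ j < n, hist L' Mp K j := hAll L' Mp hLL' hM0L'_Mp
  have hH_L'M' : ∀ j < n, hist L' M' K j := hAll L' M' hLL' hM'
  -- the four legs
  have h1 : |klLocalPart L M β U μ K n θ - klLocalPart L Mp β U μ K n θ| ≤ a / L :=
    hcut L M Mp le_rfl hM hMMp hH_LM hH_LMp θ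
  have h2 : |klLocalPart L Mp β U μ K n θ - klLocalPart Lp Mp β U μ K n θ| ≤ b / L :=
    hsp L Lp Mp le_rfl hLdvd hM0L_Mp hM0Lp hH_LMp hH_LpMp θ
  have h3 : |klLocalPart L' Mp β U μ K n θ - klLocalPart Lp Mp β U μ K n θ| ≤ b / L' :=
    hsp L' Lp Mp hLL' hL'dvd hM0L'_Mp hM0Lp hH_L'Mp hH_LpMp θ
  have h4 : |klLocalPart L' M' β U μ K n θ - klLocalPart L' Mp β U μ K n θ| ≤ a / L' :=
    hcut L' M' Mp hLL' hM' hM'Mp hH_L'M' hH_L'Mp θ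
  -- `1/L′ ≤ 1/L`
  have hLR : (0 : ℝ) < L := by exact_mod_cast hL0
  have hLL'R : (L : ℝ) ≤ L' := by exact_mod_cast hLL'
  have h3' : |klLocalPart L' Mp β U μ K n θ - klLocalPart Lp Mp β U μ K n θ| ≤ b / L :=
    h3.trans (div_le_div_of_nonneg_left hb hLR hLL'R)
  have h4' : |klLocalPart L' M' β U μ K n θ - klLocalPart L' Mp β U μ K n θ| ≤ a / L :=
    h4.trans (div_le_div_of_nonneg_left ha hLR hLL'R)
  -- chain
  have key : |klLocalPart L M β U μ K n θ - klLocalPart L' M' β U μ K n θ| ≤ a / L + b / L + b / L + a / L := by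
    have e : klLocalPart L M β U μ K n θ - klLocalPart L' M' β U μ K n θ =
        (klLocalPart L M β U μ K n θ - klLocalPart L Mp β U μ K n θ) +
        (klLocalPart L Mp β U μ K n θ - klLocalPart Lp Mp β U μ K n θ) -
        (klLocalPart L' Mp β U μ K n θ - klLocalPart Lp Mp β U μ K n θ) -
        (klLocalPart L' M' β U μ K n θ - klLocalPart L' Mp β U μ K n θ) := by ring
    rw [e]
    refine (abs_sub _ _).trans ((add_le_add ((abs_sub _ _).trans (add_le_add ((abs_add_le _ _).trans (add_le_add h1 h2)) h3')) h4'))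
  refine key.trans ?_
  rw [show a / L + b / L + b / L + a / L = (2 * a + 2 * b) / L by ring]
  exact div_le_div_of_nonneg_right hab hLR.le

/-- **(E3f-A) from two nested legs, quarter-budget form**: legs `≤ Q.CL β n / (4 L₁)` each. -/
theorem twoLegVolumeRateA_of_nestedLegs_quarter (hCL : 0 ≤ Q.CL β n)
    (hcut : ∀ (L₁ M₁ M₂ : ℕ) [NeZero L₁] [NeZero M₁] [NeZero M₂], L ≤ L₁ → Q.M0 β L₁ ≤ M₁ → M₁ ≤ M₂ →
      (∀ j < n, hist L₁ M₁ K j) → (∀ j < n, hist L₁ M₂ K j) →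
        ∀ θ : ℝ, |klLocalPart L₁ M₁ β U μ K n θ - klLocalPart L₁ M₂ β U μ K n θ| ≤ Q.CL β n / 4 / L₁)
    (hsp : ∀ (L₁ L₂ M₂ : ℕ) [NeZero L₁] [NeZero L₂] [NeZero M₂], L ≤ L₁ → L₁ ∣ L₂ → Q.M0 β L₁ ≤ M₂ → Q.M0 β L₂ ≤ M₂ →
      (∀ j < n, hist L₁ M₂ K j) → (∀ j < n, hist L₂ M₂ K j) →
        ∀ θ : ℝ, |klLocalPart L₁ M₂ β U μ K n θ - klLocalPart L₂ M₂ β U μ K n θ| ≤ Q.CL β n / 4 / L₁) :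
    TwoLegVolumeRateA L M hist Q β U μ K n :=
  twoLegVolumeRateA_of_nestedLegs (a := Q.CL β n / 4) (b := Q.CL β n / 4) (by positivity) (by positivity) (by linarith) hcut hsp

/-- **Same-cutoff form** (when the scale-`n` local part does not depend on the Matsubara cutoff beyond the threshold — e.g. if the cutoff leg is
discharged EXACTLY by the UV-shell embedding — only the spatial nested leg is owed, with half the budget). -/
theorem twoLegVolumeRateA_of_cutoffFree_nested (hCL : 0 ≤ Q.CL β n)
    (hcut : ∀ (L₁ M₁ M₂ : ℕ) [NeZero L₁] [NeZero M₁] [NeZero M₂], L ≤ L₁ → Q.M0 β L₁ ≤ M₁ → M₁ ≤ M₂ →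
      (∀ j < n, hist L₁ M₁ K j) → (∀ j < n, hist L₁ M₂ K j) →
        ∀ θ : ℝ, klLocalPart L₁ M₁ β U μ K n θ = klLocalPart L₁ M₂ β U μ K n θ)
    (hsp : ∀ (L₁ L₂ M₂ : ℕ) [NeZero L₁] [NeZero L₂] [NeZero M₂], L ≤ L₁ → L₁ ∣ L₂ → Q.M0 β L₁ ≤ M₂ → Q.M0 β L₂ ≤ M₂ →
      (∀ j < n, hist L₁ M₂ K j) → (∀ j < n, hist L₂ M₂ K j) →
        ∀ θ : ℝ, |klLocalPart L₁ M₂ β U μ K n θ - klLocalPart L₂ M₂ β U μ K n θ| ≤ Q.CL β n / 2 / L₁) :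
    TwoLegVolumeRateA L M hist Q β U μ K n :=
  twoLegVolumeRateA_of_nestedLegs (a := 0) (b := Q.CL β n / 2) le_rfl (by positivity) (by linarith)
    (fun L₁ M₁ M₂ _ _ _ hL hM₁ hM₁₂ hh₁ hh₂ θ => by
      rw [hcut L₁ M₁ M₂ hL hM₁ hM₁₂ hh₁ hh₂ θ, sub_self, abs_zero, zero_div])
    hsp

/-- **The V15 slot from its two cores and two nested legs** (the shape the gen-6 `stub_twoLeg_step` / `stub_twoLeg_scale0` provers deliver). -/
theorem twoLegStepV15_of_cores_of_nestedLegs {G : GeoConsts} {P : SplitConsts} {R : RenConsts}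
    (h1 : TwoLegCoreTD L M (histV15 L M G P Q R β U μ) G P Q R β U μ K n) (h2 : TwoLegSizesMSTQ L M G Q R β U μ K n) (hCL : 0 ≤ Q.CL β n)
    (hcut : ∀ (L₁ M₁ M₂ : ℕ) [NeZero L₁] [NeZero M₁] [NeZero M₂], L ≤ L₁ → Q.M0 β L₁ ≤ M₁ → M₁ ≤ M₂ →
      (∀ j < n, histV15 L₁ M₁ G P Q R β U μ K j ∧ TwoLegCoreTD L₁ M₁ (histV15 L₁ M₁ G P Q R β U μ) G P Q R β U μ K j ∧
        TwoLegSizesMSTQ L₁ M₁ G Q R β U μ K j) →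
      (∀ j < n, histV15 L₁ M₂ G P Q R β U μ K j ∧ TwoLegCoreTD L₁ M₂ (histV15 L₁ M₂ G P Q R β U μ) G P Q R β U μ K j ∧
        TwoLegSizesMSTQ L₁ M₂ G Q R β U μ K j) →
        ∀ θ : ℝ, |klLocalPart L₁ M₁ β U μ K n θ - klLocalPart L₁ M₂ β U μ K n θ| ≤ Q.CL β n / 4 / L₁)
    (hsp : ∀ (L₁ L₂ M₂ : ℕ) [NeZero L₁] [NeZero L₂] [NeZero M₂], L ≤ L₁ → L₁ ∣ L₂ → Q.M0 β L₁ ≤ M₂ → Q.M0 β L₂ ≤ M₂ →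
      (∀ j < n, histV15 L₁ M₂ G P Q R β U μ K j ∧ TwoLegCoreTD L₁ M₂ (histV15 L₁ M₂ G P Q R β U μ) G P Q R β U μ K j ∧
        TwoLegSizesMSTQ L₁ M₂ G Q R β U μ K j) →
      (∀ j < n, histV15 L₂ M₂ G P Q R β U μ K j ∧ TwoLegCoreTD L₂ M₂ (histV15 L₂ M₂ G P Q R β U μ) G P Q R β U μ K j ∧
        TwoLegSizesMSTQ L₂ M₂ G Q R β U μ K j) →
        ∀ θ : ℝ, |klLocalPart L₁ M₂ β U μ K n θ - klLocalPart L₂ M₂ β U μ K n θ| ≤ Q.CL β n / 4 / L₁) :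
    TwoLegStepV15 L M G P Q R β U μ K n :=
  twoLegStepV15_of_conjuncts h1 h2 (twoLegVolumeRateA_of_nestedLegs_quarter hCL hcut hsp)

end Summit.HubbardSuperconductivity.HubbardSuperconductivity.Theorems.KLRegimeSplit

end
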